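import Summits.AnomalousDissipation.AnomalousDissipation.Theses.MomentParity
import Summits.AnomalousDissipation.AnomalousDissipation.Theses.Correlation
import Summits.AnomalousDissipation.AnomalousDissipation.Theorems.MomentParityResolvedDissipationOfLerayHopfEnergyEquality
import Summits.AnomalousDissipation.AnomalousDissipation.Theorems.MomentParityResolvedDissipationNoMeanLeakagePrep

/-!
# `Correlation.NoMeanLeakage ⟹ MomentParity.ResolvedDissipation` — the crux of route MomentParity
# (stmt-AnomalousDissipation-14284) follows from an EXISTING open item of route Correlation (stmt-AnomalousDissipation-14265)

Supports stmt-AnomalousDissipation-14284 (line `enstrophy-ui-transfer`, skeleton v11 of lead c10: proves the registered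
stubs S19 `stub_genericLeakingPoint` and S17 `stub_resolvedOfNoMeanLeakage`; nothing here closes an item — the remaining
registered leaf S16 `stub_noMeanLeakage` IS the ledger item stmt-AnomalousDissipation-14265 `Correlation.NoMeanLeakage`).

**Statement.** `NoMeanLeakage` (route Correlation #8, also wanted by route CriticalLayer): for every `ν > 0`, every smooth
divergence-free mean-zero steady force `f` on `T³` and EVERY global Leray–Hopf solution `u` (tree's strict sense
`Torus.IsGlobalLerayHopf`), the mean work does not exceed the mean viscous dissipation,
`limsup_T T⁻¹∫₀ᵀ (f, u) ≤ limsup_T T⁻¹∫₀ᵀ ν‖∇u‖²` (`longTimeAvgSup`, `meanDissipation`). THEN `ResolvedDissipation`: at every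
`(f, ν, R)` one schedule resolves the mean enstrophy of all bounded Galerkin-invariant laws uniformly in the level.

**Why this refines the bracket.** The landed upper bracket is `LHEE ⟹ ResolvedDissipation`
(`LhBracket.resolvedDissipation_of_lerayHopfEnergyEquality`; LHEE = Leray–Hopf energy EQUALITY between positive times).
LHEE implies `NoMeanLeakage` (telescoping the energy equality over `[t₀, T]` and dividing by `T`, FMRT 2001 (12.38)–(12.39)),
not conversely (a single energy drop is invisible in long-time means), so the leaf is WEAKER, and — unlike LHEE/GEE/TUI — it
is an EXISTING statement item of the ledger (stmt-AnomalousDissipation-14265), on which the crux can honestly park.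

**Proof** (`resolvedAt_of_noMeanLeakage`). By contradiction, the Vishik–Fursikov lift of the LhBracket line verbatim up to
the limit law: kill shape ⟹ (S1 `stub_leakingSequence`) levels `N_j → ∞` and admissible laws with a work–dissipation margin
`η = ν/(n+1)` at every cutoff ⟹ (`stub_levelLaw`, `stub_levelDissMean`, `stub_levelWorkMean`) shift-invariant level laws on
the compact trajectory space `𝒦 = pathSpace R (pathLip ν A R)` ⟹ (S2 `stub_limitLawDefect`) a shift-invariant limit law
`Q` with the margin at every cutoff. NEW from here: (S19 `stub_genericLeakingPoint`) Birkhoff's pointwise ergodic theorem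
(tree `Literature.Dynamics.Ergodic.birkhoff_ergodic_theorem_holds`) on `(𝒦, Q, θ)` for the continuous work functional
`W` and the FULL unit-viscosity dissipation functional `G = (⨆_K ofReal dissMean 1 K)·toReal`, integrable with
`ν∫G dQ ≤ ∫W dQ − η` by monotone convergence; since `∫(W* − νG*) dQ ≥ η > 0` the event `{νG* < W*}` is charged, and a
`Q`-generic point `x ∈ supp Q` of it has Birkhoff limits `w = W*(x) > ν g = νG*(x)` and `G` finite along its orbit;
(landed `stub_supportApprox` + `stub_realisation`) `x` is realised after a shift `s ≥ 0` by a GLOBAL LERAY–HOPF solution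
`u`; (S18 `stub_meansOfRealisation`) along `u`, `longTimeAvgSup (f, u) = w` and `meanDissipation ν u ≤ ν g < w` — a
Leray–Hopf solution leaking in the mean, contradicting `NoMeanLeakage(ν, f)`.

References: Foias–Rosa–Temam 2013 (arXiv:1111.6257) Thm 3.1 (proof); Foias–Manley–Rosa–Temam 2001 Ch. IV (1.31) and App. B,
(12.38)–(12.39); Vishik–Fursikov 1988 Ch. IV; Dajani–Kalle 2021 Thm 3.1.1; Doering–Foias 2002 §2.
-/

noncomputable section

set_option linter.dupNamespace false

namespace Summit.AnomalousDissipation.AnomalousDissipation.Theorems.MomentParityResolvedDissipation.NoMeanLeakageBridge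

open MeasureTheory Filter Topology Set Function Metric UnitAddTorus
open scoped ENNReal InnerProductSpace RealInnerProductSpace BigOperators
open Literature.Analysis.FunctionSpaces Literature.Analysis.FunctionSpaces.Torus
open Literature.Analysis.FluidPDE Literature.Analysis.FluidPDE.Torus
open Summit.AnomalousDissipation.AnomalousDissipation.Theses.MomentParity
open Summit.AnomalousDissipation.AnomalousDissipation.Theorems.MomentParity
open Summit.AnomalousDissipation.AnomalousDissipation.Theorems.MomentParityResolvedDissipation.LhBracket
open Summit.AnomalousDissipation.AnomalousDissipation.Theorems.QuarticGate.Negative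
  (IsLevel IsBandTest polyGrad IsPolyStationary)
open Summit.AnomalousDissipation.AnomalousDissipation.Theorems

/-! ### S19 · Birkhoff selection of a generic leaking path -/

/-- **S19 · `stub_genericLeakingPoint` — a generic leaking path.** Let `Q` be a shift-invariant probability law on
`𝒦 = pathSpace R L` whose mean unit-window work exceeds `∫ dissMean ν K dQ` by a margin `η > 0` at every cutoff `K`
(`ν > 0`). Then some point `x` of `supp Q` has Birkhoff limits `w` of the work functional (integer-window means of
`Σ'_k Re⟪𝓕f k, x̄(t,k)⟫`) and `g` of the full unit-viscosity dissipation functional `G = (⨆_K ofReal dissMean 1 K)·toReal`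
along the shift, `G` is finite along the whole orbit of `x`, and `ν g < w`. Proof: `ν∫G dQ ≤ ∫W dQ − η` (monotone
convergence, `lintegral_iSup_ofReal_dissMean`); Birkhoff (`birkhoff_ergodic_theorem_holds`) for `W` and `G`;
`∫ (W* − νG*) dQ ≥ η > 0` charges `{νG* < W*}`; intersect with the conull sets (support, convergence, finiteness along
the orbit by measure preservation). [folklore; DajaniKalle2021 Thm 3.1.1] -/
theorem stub_genericLeakingPoint :
    ∀ (R : ℝ) (L : (Fin 3 → ℤ) → ℝ) (f : UnitAddTorus (Fin 3) → EuclideanSpace ℝ (Fin 3)),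
      Torus.IsSmooth f → ∀ (ν η : ℝ), 0 < ν → 0 < η →
    ∀ (Q : Measure ↥(pathSpace R L)), IsProbabilityMeasure Q →
      Q.map (pathShiftOn R L (pathShift_mapsTo R L)) = Q →
      (∀ K : ℕ, (∫ ω, dissMean ν K ω.1 ∂Q) + η ≤
        ∫ ω, (∫ t in (0 : ℝ)..1, ∑' k : Fin 3 → ℤ,
          (inner ℂ (mFourierCoeff (EuclideanSpace.complexify ∘ f) k) (pathExt ω.1 t k)).re) ∂Q) →
    ∃ x : ↥(pathSpace R L), x ∈ Q.support ∧ ∃ w g : ℝ,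
      Tendsto (fun m : ℕ => (m : ℝ)⁻¹ * ∫ t in (0 : ℝ)..m, ∑' k : Fin 3 → ℤ,
        (inner ℂ (mFourierCoeff (EuclideanSpace.complexify ∘ f) k) (pathExt x.1 t k)).re) atTop (𝓝 w) ∧
      Tendsto (fun m : ℕ => (m : ℝ)⁻¹ * ∑ i ∈ Finset.range m,
        (⨆ K : ℕ, ENNReal.ofReal (dissMean 1 K (pathShift^[i] x.1))).toReal) atTop (𝓝 g) ∧
      (∀ i : ℕ, (⨆ K : ℕ, ENNReal.ofReal (dissMean 1 K (pathShift^[i] x.1))) ≠ ⊤) ∧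
      ν * g < w := by
  intro R L f hf ν η hν hη Q hQ hQθ hmargin
  haveI := hQ
  haveI : CompactSpace ↥(pathSpace R L) := compactSpace_pathSpace R L
  have hθQ : MeasurePreserving (pathShiftOn R L (pathShift_mapsTo R L)) Q Q :=
    ⟨(continuous_pathShiftOn R L).measurable, hQθ⟩
  -- the two observables
  obtain ⟨W, hW⟩ : ∃ W : ↥(pathSpace R L) → ℝ, W = fun ω => ∫ t in (0 : ℝ)..1,
      ∑' k : Fin 3 → ℤ, (inner ℂ (mFourierCoeff (EuclideanSpace.complexify ∘ f) k) (pathExt ω.1 t k)).re :=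
    ⟨_, rfl⟩
  obtain ⟨Ge, hGe⟩ : ∃ Ge : ↥(pathSpace R L) → ℝ≥0∞, Ge = fun ω =>
      ⨆ K : ℕ, ENNReal.ofReal (dissMean 1 K ω.1) := ⟨_, rfl⟩
  have hWint : Integrable W Q := by
    rw [hW]
    exact (LimitLawDefect.continuous_workMean hf R L).integrable_of_hasCompactSupport
      (HasCompactSupport.of_compactSpace _)
  -- the margin in unit viscosity: `ν ∫ dissMean 1 K dQ + η ≤ ∫ W dQ`
  have hmarg1 : ∀ K : ℕ, ν * (∫ ω, dissMean 1 K ω.1 ∂Q) + η ≤ ∫ ω, W ω ∂Q := by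
    intro K
    have h := hmargin K
    have heq : (∫ ω, dissMean ν K ω.1 ∂Q) = ν * ∫ ω, dissMean 1 K ω.1 ∂Q := by
      rw [← integral_const_mul]
      exact integral_congr_ae (ae_of_all _ fun ω => dissMean_eq_mul_dissMean_one ν K ω.1)
    rw [heq, ← hW] at h
    exact h
  have hW0 : η ≤ ∫ ω, W ω ∂Q := by
    have h := hmarg1 0
    have h0 : 0 ≤ ∫ ω, dissMean 1 0 ω.1 ∂Q := integral_nonneg fun ω => (dissMean_mem_Icc zero_le_one 0 ω.2).1
    have h1 : 0 ≤ ν * ∫ ω, dissMean 1 0 ω.1 ∂Q := mul_nonneg hν.le h0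
    linarith
  -- `∫⁻ Ge dQ ≤ (∫ W dQ - η) / ν`
  have hquot : 0 ≤ ((∫ ω, W ω ∂Q) - η) / ν := div_nonneg (by linarith) hν.le
  have hlin : ∫⁻ ω, Ge ω ∂Q ≤ ENNReal.ofReal (((∫ ω, W ω ∂Q) - η) / ν) := by
    rw [hGe, lintegral_iSup_ofReal_dissMean Q]
    refine iSup_le fun K => ENNReal.ofReal_le_ofReal ?_
    rw [le_div_iff₀ hν]
    have h := hmarg1 K
    linarith
  have hGe_meas : Measurable Ge := by rw [hGe]; exact measurable_iSup_ofReal_dissMean R L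
  have hGe_ne : ∫⁻ ω, Ge ω ∂Q ≠ ⊤ := ne_top_of_le_ne_top ENNReal.ofReal_ne_top hlin
  have hGe_lt : ∀ᵐ ω ∂Q, Ge ω < ⊤ := ae_lt_top hGe_meas hGe_ne
  have hGint : Integrable (fun ω => (Ge ω).toReal) Q :=
    integrable_toReal_of_lintegral_ne_top hGe_meas.aemeasurable hGe_ne
  have hGI : ν * ∫ ω, (Ge ω).toReal ∂Q ≤ (∫ ω, W ω ∂Q) - η := by
    have h1 : ∫ ω, (Ge ω).toReal ∂Q = (∫⁻ ω, Ge ω ∂Q).toReal := integral_toReal hGe_meas.aemeasurable hGe_lt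
    have h2 : (∫⁻ ω, Ge ω ∂Q).toReal ≤ ((∫ ω, W ω ∂Q) - η) / ν := by
      have := ENNReal.toReal_mono ENNReal.ofReal_ne_top hlin
      rwa [ENNReal.toReal_ofReal hquot] at this
    rw [h1]
    calc ν * (∫⁻ ω, Ge ω ∂Q).toReal ≤ ν * (((∫ ω, W ω ∂Q) - η) / ν) :=
          mul_le_mul_of_nonneg_left h2 hν.le
      _ = (∫ ω, W ω ∂Q) - η := mul_div_cancel₀ _ hν.ne'
  -- Birkhoff for the two observables
  obtain ⟨Ws, hWs_int, -, hWs_eq, hWs_lim⟩ :=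
    Literature.Dynamics.Ergodic.birkhoff_ergodic_theorem_holds Q _ hθQ W hWint
  obtain ⟨Gs, hGs_int, -, hGs_eq, hGs_lim⟩ :=
    Literature.Dynamics.Ergodic.birkhoff_ergodic_theorem_holds Q _ hθQ (fun ω => (Ge ω).toReal) hGint
  -- the event `{ν G* < W*}` is charged
  have hfreq : ∃ᵐ ω ∂Q, ν * Gs ω < Ws ω := by
    by_contra hcon
    have hle : ∀ᵐ ω ∂Q, Ws ω ≤ ν * Gs ω :=
      (not_frequently.1 hcon).mono fun ω h => not_lt.1 h
    have h1 : ∫ ω, Ws ω ∂Q ≤ ∫ ω, ν * Gs ω ∂Q := integral_mono_ae hWs_int (hGs_int.const_mul ν) hle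
    rw [integral_const_mul, hWs_eq, hGs_eq] at h1
    linarith
  -- generic conditions: support, Birkhoff convergence, finiteness of `Ge` along the orbit
  have hsupp : ∀ᵐ ω ∂Q, ω ∈ Q.support := Measure.support_mem_ae
  have hiter : ∀ᵐ ω ∂Q, ∀ i : ℕ, Ge ((pathShiftOn R L (pathShift_mapsTo R L))^[i] ω) < ⊤ := by
    rw [ae_all_iff]
    intro i
    exact (hθQ.iterate i).quasiMeasurePreserving.ae hGe_lt
  obtain ⟨x, hxlt, hx_supp, hxW, hxG, hxfin⟩ :=
    (hfreq.and_eventually (hsupp.and (hWs_lim.and (hGs_lim.and hiter)))).exists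
  refine ⟨x, hx_supp, Ws x, Gs x, ?_, ?_, fun i => ?_, hxlt⟩
  · refine hxW.congr fun m => ?_
    rw [birkhoffAverage, hW, birkhoffSum_workMean hf x m, smul_eq_mul]
  · refine hxG.congr fun m => ?_
    rw [birkhoffAverage, birkhoffSum, smul_eq_mul, hGe]
    simp only [coe_iterate_pathShiftOn]
  · have h := hxfin i
    rw [hGe] at h
    simp only [coe_iterate_pathShiftOn] at h
    exact h.ne

/-! ### The bridge per force and viscosity -/

/-- **NoMeanLeakage(ν, f) ⟹ ResolvedDissipation at (f, ν, R).** Fix `ν > 0` and a smooth mean-zero steady force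
`f`. If every global Leray–Hopf weak solution of NS(ν, f) on `T³` (tree's sense `Torus.IsGlobalLerayHopf`) has no
leakage IN THE MEAN — `⟨(f, u)⟩ ≤ ν⟨‖∇u‖²⟩` as `limsup`s of running time means (`longTimeAvgSup`,
`meanDissipation`) — then for every radius `R` ONE schedule `κ` resolves the mean enstrophy of every level-`N`
admissible law (probability, level-`N` carried, supported in `‖u‖ ≤ R`, stationary at all orders for Galerkin
NS) at every tolerance. Proof: the Vishik–Fursikov lift of a leaking sequence of the LhBracket line up to the
shift-invariant limit law `Q` with a work–dissipation margin `η > 0` at every cutoff (landed S1, level laws, S2);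
a `Q`-generic leaking support point (S19 `stub_genericLeakingPoint`: Birkhoff for the work and the full
dissipation functionals); its realisation by a global Leray–Hopf solution `u` (landed `stub_supportApprox`,
`stub_realisation`), along which `longTimeAvgSup (f, u) = w > ν g ≥ meanDissipation ν u`
(S18 `stub_meansOfRealisation`) — a global Leray–Hopf solution LEAKING IN THE MEAN, contradicting the hypothesis.
[folklore lift: FoiasRosaTemam2013 Thm 3.1; FMRTTurbulence2001 Ch. IV App. B; DajaniKalle2021 Thm 3.1.1] -/
theorem resolvedAt_of_noMeanLeakage {ν : ℝ} (hν : 0 < ν)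
    {f : UnitAddTorus (Fin 3) → EuclideanSpace ℝ (Fin 3)} (hf : Torus.IsSmooth f) (hf0 : Torus.HasZeroMean f)
    (hNML : ∀ (u₀ : UnitAddTorus (Fin 3) → EuclideanSpace ℝ (Fin 3))
      (u : ℝ → UnitAddTorus (Fin 3) → EuclideanSpace ℝ (Fin 3)),
      Torus.IsGlobalLerayHopf ν (fun _ => f) u₀ u →
      longTimeAvgSup (fun t => ∫ x, ⟪f x, u t x⟫_ℝ) ≤ meanDissipation ν u)
    (R : ℝ) :
    ∃ κ : ℕ → ℕ, ∀ (N : ℕ) (μ : Measure (Torus.energySpace (Fin 3))), IsProbabilityMeasure μ →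
      (∀ᵐ u ∂μ, IsLevel N u) → (∀ᵐ u ∂μ, ‖u‖ ≤ R) →
      ResolvedDissipation.Negative.IsStationary ν f N μ →
      ∀ n : ℕ, ResolvedDissipation.Negative.IsResolved κ μ n := by
  by_contra hRD
  -- the kill shape at `(f, ν, R)`: one tolerance `n` and, for every cutoff, an unresolved admissible law
  have hkill : ∃ n : ℕ, ∀ K : ℕ, ∃ (N : ℕ) (μ : Measure (Torus.energySpace (Fin 3))),
      IsProbabilityMeasure μ ∧ (∀ᵐ u ∂μ, IsLevel N u) ∧ (∀ᵐ u ∂μ, ‖u‖ ≤ R) ∧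
      ResolvedDissipation.Negative.IsStationary ν f N μ ∧
      ¬ ResolvedDissipation.Negative.IsResolved (fun _ => K) μ n := by
    by_contra hcon
    push Not at hcon
    choose Kf hKf using hcon
    exact hRD ⟨Kf, fun N μ hp hl hb hs n => hKf n N μ hp hl hb hs⟩
  obtain ⟨n, hK⟩ := hkill
  -- S1: the leaking sequence
  obtain ⟨Ns, μs, hNs, hprob, hlev, hball, hstat, hdef⟩ :=
    LeakingSequence.stub_leakingSequence ν hν f hf R n hK
  haveI hprob' : ∀ j, IsProbabilityMeasure (μs j) := hprob
  -- the margin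
  set η : ℝ := ν * ((n : ℝ) + 1)⁻¹ with hη
  have hηpos : 0 < η := by positivity
  -- the coefficient bound and the trajectory space
  set A : ℝ := ∫ x, ‖f x‖ with hA
  have hA0 : 0 ≤ A := integral_nonneg fun _ => norm_nonneg _
  have hAk : ∀ j k, ‖coeffExt (freqBall (Ns j)) (fourierRestrict (freqBall (Ns j)) f) k‖ ≤ A :=
    fun j k => norm_coeffExt_fourierRestrict_le hf (Ns j) k
  set L : (Fin 3 → ℤ) → ℝ := pathLip ν A R with hL
  have hL0 : ∀ k, 0 ≤ L k := fun k => zero_le_one.trans (one_le_pathLip hA0 k)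
  set ω₀ : ↥(pathSpace R L) := ⟨0, zero_mem_pathSpace R hL0⟩ with hω₀
  -- the clauses of the level laws
  have h1 : ∀ j, ∀ᵐ u ∂(μs j), ∀ k ∉ (freqBall (Ns j)).erase (0 : Fin 3 → ℤ),
      mFourierCoeff (EuclideanSpace.complexify ∘
        (u.1 : UnitAddTorus (Fin 3) → EuclideanSpace ℝ (Fin 3))) k = 0 :=
    fun j => (hlev j).mono fun u hu => hu
  have hpoly : ∀ j, ∀ d : ℕ, IsPolyStationary ν f (Ns j) d (μs j) :=
    fun j d m g P hg _ => hstat j m g P hg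
  have h4 : ∀ j, ∀ Φ : CylindricalTest (Fin 3),
      (∀ i, ∀ k ∉ (freqBall (Ns j)).erase (0 : Fin 3 → ℤ),
        mFourierCoeff (EuclideanSpace.complexify ∘ (Φ.g i)) k = 0) →
        Integrable (fun u => nsGeneratorPairing ν f u (Φ.grad u)) (μs j) ∧
          ∫ u, nsGeneratorPairing ν f u (Φ.grad u) ∂(μs j) = 0 :=
    fun j Φ hΦ => MomentParityResolvedDissipation.admissible_rows_cylindrical hf (hlev j) (hball j) (hpoly j) Φ hΦ
  -- the level laws on the trajectory space
  set P : ℕ → Measure ↥(pathSpace R L) := fun j =>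
    ((μs j).map fun u : Torus.energySpace (Fin 3) =>
        fourierRestrict (freqBall (Ns j)) (u.1 : UnitAddTorus (Fin 3) → EuclideanSpace ℝ (Fin 3))).map
      (orbitPathOn ν (fourierRestrict (freqBall (Ns j)) f) R L ω₀) with hPdef
  have hlaw := fun j => stub_levelLaw hν hf hf0 (hAk j) hA0 ω₀ (h1 j) (hball j) (h4 j)
  have hPprob : ∀ j, IsProbabilityMeasure (P j) := fun j => (hlaw j).1
  have hθ : ∀ j, (P j).map (pathShiftOn R L (pathShift_mapsTo R L)) = P j := fun j => (hlaw j).2.1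
  have hcar := fun j => (hlaw j).2.2
  -- the margin at every level, in trajectory-space form (landed `stub_levelDissMean` + S2a)
  have hmargin : ∀ j K : ℕ, K ≤ j →
      (∫ ω, dissMean ν K ω.1 ∂(P j)) + η ≤
        ∫ ω, (∫ t in (0 : ℝ)..1, ∑' k : Fin 3 → ℤ,
          (inner ℂ (mFourierCoeff (EuclideanSpace.complexify ∘ f) k) (pathExt ω.1 t k)).re) ∂(P j) := by
    intro j K hKj
    rw [hPdef, stub_levelDissMean hν hf hf0 (hAk j) hA0 ω₀ (h1 j) (hball j) (h4 j) K,
      LevelWorkMean.stub_levelWorkMean ν hν f hf hf0 (Ns j) R A (hAk j) hA0 ω₀ (μs j) (hprob j) (h1 j)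
        (hball j) (h4 j)]
    exact hdef j K hKj
  -- S2: the limit law with the margin
  obtain ⟨Q, hQprob, hQθ, hQmargin, hQsupp⟩ :=
    LimitLawDefect.stub_limitLawDefect f hf R L ν η P hPprob hθ hmargin
  haveI := hQprob
  -- NEW: a generic leaking support point (Birkhoff), its realisation, and its long-time means
  obtain ⟨x, hx_supp, w, g, hxw, hxg, hxfin, hlt⟩ :=
    stub_genericLeakingPoint R L f hf ν η hν hηpos Q hQprob hQθ hQmargin
  obtain ⟨φ, hφ, c, hc, hconf, hmem, hlim⟩ :=
    stub_supportApprox (g := fun j => fourierRestrict (freqBall (Ns j)) f) P hcar (hQsupp x hx_supp)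
  obtain ⟨s, hs, u, hLH, hu⟩ :=
    stub_realisation hν hf (hNs.comp hφ.tendsto_atTop) hc hconf hmem x.2 hlim
  obtain ⟨hWeq, hDle⟩ := stub_meansOfRealisation R L f hf ν hν.le x.1 x.2 s hs u hu w g hxw hxg hxfin
  -- NoMeanLeakage along `u`: `w ≤ meanDissipation ν u ≤ ν g < w`
  have hNMLu := hNML (u 0) u hLH
  rw [hWeq] at hNMLu
  linarith

/-! ### S17 · the global bridge -/

/-- **S17 · `stub_resolvedOfNoMeanLeakage` — `Correlation.NoMeanLeakage ⟹ MomentParity.ResolvedDissipation`.** The crux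
of route MomentParity (stmt-AnomalousDissipation-14284) follows from the crux `NoMeanLeakage` of route Correlation
(stmt-AnomalousDissipation-14265): "for every `ν > 0`, every smooth divergence-free mean-zero steady force and EVERY global
Leray–Hopf solution, the mean work does not exceed the mean viscous dissipation, `⟨(f,u)⟩ ≤ ν⟨‖∇u‖²⟩`". Since the Leray–Hopf
energy equality between positive times (LHEE) implies `NoMeanLeakage` (telescoping; FMRT 2001 (12.38)–(12.39)), this REFINES
the landed bracket `LHEE ⟹ ResolvedDissipation` (`LhBracket.resolvedDissipation_of_lerayHopfEnergyEquality`) through an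
EXISTING ledger item: LHEE ⟹ NoMeanLeakage ⟹ ResolvedDissipation. Immediate from `resolvedAt_of_noMeanLeakage`
(`ResolvedDissipation` unfolds to its clauses by `ResolvedDissipation.Negative.resolvedDissipation_iff`). -/
theorem stub_resolvedOfNoMeanLeakage :
    Summit.AnomalousDissipation.AnomalousDissipation.Theses.Correlation.NoMeanLeakage → ResolvedDissipation := by
  intro hNML
  rw [ResolvedDissipation.Negative.resolvedDissipation_iff]
  intro f hf hdiv hf0 ν hν R
  exact resolvedAt_of_noMeanLeakage hν hf hf0
    (fun u₀ u hLH => hNML ν f u₀ u hν hf hdiv hf0 hLH) R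

/-- **`Correlation.NoMeanLeakage ⟹ MomentParity.ResolvedDissipation`** (descriptive alias of S17
`stub_resolvedOfNoMeanLeakage` for importers). -/
theorem resolvedDissipation_of_noMeanLeakage :
    Summit.AnomalousDissipation.AnomalousDissipation.Theses.Correlation.NoMeanLeakage → ResolvedDissipation :=
  stub_resolvedOfNoMeanLeakage

end Summit.AnomalousDissipation.AnomalousDissipation.Theorems.MomentParityResolvedDissipation.NoMeanLeakageBridge

end
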